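import Mathlib
import HarnessLib
import Summits.Ventures.LatticeQCDFlow.Scoring.KArmHomogeneityLocalPower
import Summits.Ventures.LatticeQCDFlow.Scoring.GaussianCombinationLimit

/-!
# THE `k`-ARM HOMOGENEITY TEST WITH UNEQUAL SAMPLE SIZES PER CODE: READ ALONG `m_r(k)` WITH
# `m_r(k)/k → λ_r > 0`, THE ACCEPTANCE PROBABILITY STILL TENDS TO THE NOMINAL
# `N^{⊗R}{Σ_{r≠0} z_r² ≤ c}` UNDER EQUAL TARGETS, AND TO THE SHIFTED BALL WITH DRIFTS `h_r/√λ_r`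
# AND VARIANCES `s_r/λ_r` UNDER LOCAL ALTERNATIVES

HONEST FRAMING: exact (Metropolis-corrected) sampling algorithms for lattice gauge theory;
figures of merit are autocorrelation/cost numbers at stated couplings and volumes; no
continuum-physics claim.

Venture `LatticeQCDFlow` (cell pub-lqcd), topic `Scoring`; FANOUT row 4 (`s0-u1-b`, GEN-34).
NEW WORK of the cell (classical asymptotics; our formalisation), no definition, nothing cited.

WHY (row 4).  The arms the cell compares are never run at the same sample size (arm A of row 4 had
sixteen streams where arm B had four; β-columns differ in length).  `Scoring/KArmHomogeneityCoverage`
and `Scoring/KArmHomogeneityLocalPower` index every code by the SAME `k` and list unequal sizes as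
NOT CLAIMED.  This file reads code `r` at its own sample size `m_r(k)` with `m_r(k)/k → λ_r > 0`
and shows nothing else changes: the `√k`-scaled column `√k (S^r_{m_r(k)} − a)` converges to
`Z_r/√λ_r ∼ N(h_r/√λ_r, s_r/λ_r)` (subsequence + Slutsky with the deterministic factor
`√(k/m_r(k)) → 1/√λ_r`, eventual-agreement device for the finitely many `k` with `m_r(k) = 0`), the
scaled error bar `k·V̂^r_{m_r(k)} → s_r/λ_r` almost surely, so `Scoring/KArmHomogeneityLocalPower`
applies verbatim with `(h_r, s_r)` replaced by `(h_r/√λ_r, s_r/λ_r)`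
(**`kArm_homogeneity_localPower_unequalSizes`**).  With equal targets (`h ≡ 0`) the limit is the
NOMINAL central functional, whatever the `λ_r` (**`kArm_homogeneity_coverage_unequalSizes`**): the
calibration of the one-shot test is insensitive to how the total budget is split between codes.

NOT CLAIMED: random sample sizes; `λ_r = 0` or `∞` (one code asymptotically negligible); rates.
-/

open MeasureTheory ProbabilityTheory Filter Topology Finset

namespace Summit.Ventures.LatticeQCDFlow.Scoring

open Set

/-! ## §1 Deterministic bookkeeping for `m(k)/k → λ > 0` -/

section Ratio

/-- `m(k)/k → λ > 0` forces `m(k) → ∞`. -/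
theorem tendsto_atTop_of_div_tendsto {m : ℕ → ℕ} {lam : ℝ} (hlam : 0 < lam)
    (hm : Tendsto (fun k : ℕ => (m k : ℝ) / k) atTop (𝓝 lam)) : Tendsto m atTop atTop := by
  have hev : ∀ᶠ k : ℕ in atTop, lam / 2 * k ≤ (m k : ℝ) := by
    have h1 : ∀ᶠ k : ℕ in atTop, lam / 2 < (m k : ℝ) / k := hm.eventually (lt_mem_nhds (by linarith))
    filter_upwards [h1, eventually_gt_atTop 0] with k hk hk0
    have hk' : (0 : ℝ) < k := by exact_mod_cast hk0
    rw [lt_div_iff₀ hk'] at hk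
    exact hk.le
  have hlin : Tendsto (fun k : ℕ => lam / 2 * (k : ℝ)) atTop atTop :=
    Tendsto.const_mul_atTop (by linarith) tendsto_natCast_atTop_atTop
  have hreal : Tendsto (fun k : ℕ => (m k : ℝ)) atTop atTop :=
    tendsto_atTop_mono' atTop hev hlin
  exact tendsto_natCast_atTop_iff.1 hreal

/-- `m(k)/k → λ > 0` ⇒ `k/m(k) → λ⁻¹`. -/
theorem tendsto_div_inv_of_div_tendsto {m : ℕ → ℕ} {lam : ℝ} (hlam : 0 < lam)
    (hm : Tendsto (fun k : ℕ => (m k : ℝ) / k) atTop (𝓝 lam)) :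
    Tendsto (fun k : ℕ => (k : ℝ) / m k) atTop (𝓝 lam⁻¹) := by
  have h := hm.inv₀ hlam.ne'
  refine h.congr' ?_
  filter_upwards with k
  rw [inv_div]

/-- `m(k)/k → λ > 0` ⇒ `√k/√(m(k)) → (√λ)⁻¹`. -/
theorem tendsto_sqrt_div_sqrt_of_div_tendsto {m : ℕ → ℕ} {lam : ℝ} (hlam : 0 < lam)
    (hm : Tendsto (fun k : ℕ => (m k : ℝ) / k) atTop (𝓝 lam)) :
    Tendsto (fun k : ℕ => Real.sqrt k / Real.sqrt (m k)) atTop (𝓝 (Real.sqrt lam)⁻¹) := by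
  have h := (tendsto_div_inv_of_div_tendsto hlam hm).sqrt
  rw [Real.sqrt_inv] at h
  refine h.congr' ?_
  filter_upwards with k
  rw [Real.sqrt_div' _ (Nat.cast_nonneg _)]

end Ratio

/-! ## §2 Reading one code along its own sample size -/

section OneCode

variable {Ω : Type*} [MeasurableSpace Ω] {P : Measure Ω} [IsProbabilityMeasure P]
variable {Ω' : Type*} [MeasurableSpace Ω'] {P' : Measure Ω'} [IsProbabilityMeasure P']

/-- **The `√k`-scaled column read at `m(k)`**: if `√j (S_j − a) ⇒ Z` and `m(k)/k → λ > 0`, then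
`√k (S_{m(k)} − a) ⇒ Z/√λ`. [ours] -/
theorem tendstoInDistribution_sqrt_scaled_comp {S : ℕ → Ω → ℝ} {a : ℝ} {Z : Ω' → ℝ}
    (hSm : ∀ j, Measurable (S j))
    (hclt : TendstoInDistribution (fun (j : ℕ) ω => Real.sqrt j * (S j ω - a)) atTop Z
      (fun _ => P) P')
    {m : ℕ → ℕ} {lam : ℝ} (hlam : 0 < lam) (hm : Tendsto (fun k : ℕ => (m k : ℝ) / k) atTop (𝓝 lam)) :
    TendstoInDistribution (fun (k : ℕ) ω => Real.sqrt k * (S (m k) ω - a)) atTop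
      (fun ω => Z ω / Real.sqrt lam) (fun _ => P) P' := by
  have hminf := tendsto_atTop_of_div_tendsto hlam hm
  -- the subsequence
  have hsub := CardConsistency.tendstoInDistribution_comp_tendsto hclt hminf
  -- Slutsky with the deterministic factor `√k/√(m k) → (√λ)⁻¹`
  have hc := tendsto_sqrt_div_sqrt_of_div_tendsto hlam hm
  have hcm : TendstoInMeasure P (fun (k : ℕ) (_ : Ω) => Real.sqrt k / Real.sqrt (m k)) atTop
      (fun _ => (Real.sqrt lam)⁻¹) :=
    tendstoInMeasure_of_tendsto_ae (fun k => aestronglyMeasurable_const)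
      (Eventually.of_forall fun _ => hc)
  have hsl := hsub.continuous_comp_prodMk_of_tendstoInMeasure_const
    (g := fun p : ℝ × ℝ => p.2 * p.1) (by fun_prop) hcm (fun k => measurable_const.aemeasurable)
  have hlim : (fun ω => (fun p : ℝ × ℝ => p.2 * p.1) (Z ω, (Real.sqrt lam)⁻¹))
      = fun ω => Z ω / Real.sqrt lam := by
    funext ω
    simp only [div_eq_inv_mul]
  rw [hlim] at hsl
  -- the printed column agrees with the product eventually (as soon as `m k ≠ 0`), surely
  have hXm : ∀ k : ℕ, Measurable fun ω => Real.sqrt k * (S (m k) ω - a) :=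
    fun k => ((hSm _).sub_const a).const_mul _
  have hYm : ∀ k : ℕ, Measurable fun ω =>
      (fun p : ℝ × ℝ => p.2 * p.1) (Real.sqrt (m k) * (S (m k) ω - a), Real.sqrt k / Real.sqrt (m k)) :=
    fun k => (((hSm _).sub_const a).const_mul _).const_mul _
  have hdev : TendstoInMeasure P ((fun (k : ℕ) ω => Real.sqrt k * (S (m k) ω - a))
      - fun (k : ℕ) ω => (fun p : ℝ × ℝ => p.2 * p.1)
          (Real.sqrt (m k) * (S (m k) ω - a), Real.sqrt k / Real.sqrt (m k))) atTop 0 := by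
    refine tendstoInMeasure_of_tendsto_ae (fun k => ((hXm k).sub (hYm k)).aestronglyMeasurable) ?_
    refine Eventually.of_forall fun ω => ?_
    refine (tendsto_const_nhds (x := (0 : ℝ))).congr' ?_
    filter_upwards [hminf.eventually (eventually_ge_atTop 1)] with k hk
    have hmk : (0 : ℝ) < m k := by exact_mod_cast hk
    have hsq : Real.sqrt (m k) ≠ 0 := (Real.sqrt_pos.2 hmk).ne'
    simp only [Pi.sub_apply]
    field_simp
    ring
  exact tendstoInDistribution_of_tendstoInMeasure_sub _ _ hsl hdev (fun k => (hXm k).aemeasurable)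

omit [IsProbabilityMeasure P'] in
/-- The limit `Z/√λ` of the rescaled column is `N(h/√λ, s/λ)` when `Z ∼ N(h, s)` (`s, λ > 0`). -/
theorem hasLaw_div_sqrt_gaussianReal {Z : Ω' → ℝ} {h s lam : ℝ} (hs : 0 ≤ s) (hlam : 0 < lam)
    (hZ : HasLaw Z (gaussianReal h s.toNNReal) P') :
    HasLaw (fun ω => Z ω / Real.sqrt lam) (gaussianReal (h / Real.sqrt lam) (s / lam).toNNReal) P' := by
  have h1 := gaussianReal_div_const hZ (Real.sqrt lam)
  convert h1 using 2
  apply NNReal.eq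
  rw [NNReal.coe_div, Real.coe_toNNReal _ hs, NNReal.coe_mk, Real.sq_sqrt hlam.le,
    Real.coe_toNNReal _ (div_nonneg hs hlam.le)]

omit [IsProbabilityMeasure P] in
/-- **The scaled error bar read at `m(k)`**: `j·V̂_j → s` a.s. and `m(k)/k → λ > 0` ⇒
`k·V̂_{m(k)} → s/λ` a.s. [ours] -/
theorem ae_tendsto_scaled_errorBar_comp {V : ℕ → Ω → ℝ} {s : ℝ}
    (hV : ∀ᵐ ω ∂P, Tendsto (fun j : ℕ => (j : ℝ) * V j ω) atTop (𝓝 s))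
    {m : ℕ → ℕ} {lam : ℝ} (hlam : 0 < lam) (hm : Tendsto (fun k : ℕ => (m k : ℝ) / k) atTop (𝓝 lam)) :
    ∀ᵐ ω ∂P, Tendsto (fun k : ℕ => (k : ℝ) * V (m k) ω) atTop (𝓝 (s / lam)) := by
  have hminf := tendsto_atTop_of_div_tendsto hlam hm
  have hratio := tendsto_div_inv_of_div_tendsto hlam hm
  filter_upwards [hV] with ω hω
  have hcomp : Tendsto (fun k : ℕ => ((m k : ℕ) : ℝ) * V (m k) ω) atTop (𝓝 s) := hω.comp hminf
  have hprod := hratio.mul hcomp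
  rw [show lam⁻¹ * s = s / lam by rw [div_eq_inv_mul]] at hprod
  refine hprod.congr' ?_
  filter_upwards [hminf.eventually (eventually_ge_atTop 1)] with k hk
  have hmk : (m k : ℝ) ≠ 0 := by exact_mod_cast (Nat.one_le_iff_ne_zero.1 hk)
  field_simp

end OneCode

/-! ## §3 The `k`-arm theorems with unequal sample sizes -/

section KArm

variable {n : ℕ} {Ωs : Fin (n + 2) → Type*} [∀ r, MeasurableSpace (Ωs r)]
  {Ps : (r : Fin (n + 2)) → Measure (Ωs r)} [∀ r, IsProbabilityMeasure (Ps r)]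
variable {Ω' : Type*} [MeasurableSpace Ω'] {P' : Measure Ω'} [IsProbabilityMeasure P']

/-- **LOCAL POWER WITH UNEQUAL SAMPLE SIZES.**  `R = n + 2` codes, code `r` with
`√j (S^r_j − a) ⇒ Z_r ∼ N(h_r, s_r)` (`s_r > 0`) and `j·V̂^r_j → s_r` a.s. along its OWN sample
size `j`, read at `j = m_r(k)` with `m_r(k)/k → λ_r > 0`; `(Z_r)` independent.  Then on `⊗_r P_r`,
for every `c`, `P(Σ_r (S^r_{m_r(k)} − m̂)²/V̂^r_{m_r(k)} ≤ c)` tends to the shifted-ball probability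
with drifts `h_r/√λ_r` and variances `s_r/λ_r`. [ours] -/
theorem kArm_homogeneity_localPower_unequalSizes {S V : (r : Fin (n + 2)) → ℕ → Ωs r → ℝ}
    {a : ℝ} {h s lam : Fin (n + 2) → ℝ} {Z : Fin (n + 2) → Ω' → ℝ} {m : Fin (n + 2) → ℕ → ℕ}
    (hs : ∀ r, 0 < s r) (hlam : ∀ r, 0 < lam r)
    (hSm : ∀ r j, Measurable (S r j)) (hVm : ∀ r j, Measurable (V r j))
    (hclt : ∀ r, TendstoInDistribution (fun (j : ℕ) ω => Real.sqrt j * (S r j ω - a)) atTop (Z r)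
      (fun _ => Ps r) P')
    (hZm : ∀ r, Measurable (Z r)) (hZ : ∀ r, HasLaw (Z r) (gaussianReal (h r) (s r).toNNReal) P')
    (hind : iIndepFun Z P')
    (hV : ∀ r, ∀ᵐ ω ∂(Ps r), Tendsto (fun j : ℕ => (j : ℝ) * V r j ω) atTop (𝓝 (s r)))
    (hm : ∀ r, Tendsto (fun k : ℕ => (m r k : ℝ) / k) atTop (𝓝 (lam r))) (c : ℝ) :
    Tendsto (fun k : ℕ => (Measure.pi Ps).real {ω : (r : Fin (n + 2)) → Ωs r |
        ∑ r, (S r (m r k) (ω r) - (∑ j, S j (m j k) (ω j) / V j (m j k) (ω j))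
          / (∑ j, (V j (m j k) (ω j))⁻¹)) ^ 2 / V r (m r k) (ω r) ≤ c})
      atTop (𝓝 ((Measure.pi fun _ : Fin (n + 2) => gaussianReal 0 1).real
        {z : Fin (n + 2) → ℝ | (z 1 + Real.sqrt (∑ r, (h r / Real.sqrt (lam r)
            - (∑ j, (h j / Real.sqrt (lam j)) / (s j / lam j)) / (∑ j, (s j / lam j)⁻¹)) ^ 2 / (s r / lam r))) ^ 2
            + ∑ r ∈ (univ.erase 0).erase 1, z r ^ 2 ≤ c})) := by
  have hs' : ∀ r, 0 < s r / lam r := fun r => div_pos (hs r) (hlam r)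
  have hclt' : ∀ r, TendstoInDistribution (fun (k : ℕ) ω => Real.sqrt k * (S r (m r k) ω - a)) atTop
      (fun ω => Z r ω / Real.sqrt (lam r)) (fun _ => Ps r) P' :=
    fun r => tendstoInDistribution_sqrt_scaled_comp (hSm r) (hclt r) (hlam r) (hm r)
  have hZm' : ∀ r, Measurable fun ω => Z r ω / Real.sqrt (lam r) := fun r => (hZm r).div_const _
  have hZ' : ∀ r, HasLaw (fun ω => Z r ω / Real.sqrt (lam r))
      (gaussianReal (h r / Real.sqrt (lam r)) (s r / lam r).toNNReal) P' :=
    fun r => hasLaw_div_sqrt_gaussianReal (hs r).le (hlam r) (hZ r)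
  have hind' : iIndepFun (fun r ω => Z r ω / Real.sqrt (lam r)) P' :=
    hind.comp (fun r x => x / Real.sqrt (lam r)) fun r => measurable_id.div_const _
  have hV' : ∀ r, ∀ᵐ ω ∂(Ps r), Tendsto (fun k : ℕ => (k : ℝ) * V r (m r k) ω) atTop (𝓝 (s r / lam r)) :=
    fun r => ae_tendsto_scaled_errorBar_comp (hV r) (hlam r) (hm r)
  exact kArm_homogeneity_localPower (S := fun r k => S r (m r k)) (V := fun r k => V r (m r k))
    hs' (fun r k => hSm r (m r k)) (fun r k => hVm r (m r k)) hclt' hZm' hZ' hind' hV' c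

/-- **CALIBRATION WITH UNEQUAL SAMPLE SIZES.**  Same setting with EQUAL targets
(`√j (S^r_j − a) ⇒ N(0, s_r)` for every code): the acceptance probability tends to the NOMINAL
`N(0,1)^{⊗R}{Σ_{r≠0} z_r² ≤ c}` whatever the proportions `λ_r` (textbook: `P(χ²_{R−1} ≤ c)`). [ours] -/
theorem kArm_homogeneity_coverage_unequalSizes {S V : (r : Fin (n + 2)) → ℕ → Ωs r → ℝ}
    {a : ℝ} {s lam : Fin (n + 2) → ℝ} {Z : Fin (n + 2) → Ω' → ℝ} {m : Fin (n + 2) → ℕ → ℕ}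
    (hs : ∀ r, 0 < s r) (hlam : ∀ r, 0 < lam r)
    (hSm : ∀ r j, Measurable (S r j)) (hVm : ∀ r j, Measurable (V r j))
    (hclt : ∀ r, TendstoInDistribution (fun (j : ℕ) ω => Real.sqrt j * (S r j ω - a)) atTop (Z r)
      (fun _ => Ps r) P')
    (hZm : ∀ r, Measurable (Z r)) (hZ : ∀ r, HasLaw (Z r) (gaussianReal 0 (s r).toNNReal) P')
    (hind : iIndepFun Z P')
    (hV : ∀ r, ∀ᵐ ω ∂(Ps r), Tendsto (fun j : ℕ => (j : ℝ) * V r j ω) atTop (𝓝 (s r)))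
    (hm : ∀ r, Tendsto (fun k : ℕ => (m r k : ℝ) / k) atTop (𝓝 (lam r))) (c : ℝ) :
    Tendsto (fun k : ℕ => (Measure.pi Ps).real {ω : (r : Fin (n + 2)) → Ωs r |
        ∑ r, (S r (m r k) (ω r) - (∑ j, S j (m j k) (ω j) / V j (m j k) (ω j))
          / (∑ j, (V j (m j k) (ω j))⁻¹)) ^ 2 / V r (m r k) (ω r) ≤ c})
      atTop (𝓝 ((Measure.pi fun _ : Fin (n + 2) => gaussianReal 0 1).real
        {z : Fin (n + 2) → ℝ | ∑ r ∈ univ.erase 0, z r ^ 2 ≤ c})) := by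
  have hZ0 : ∀ r, HasLaw (Z r) (gaussianReal ((fun _ : Fin (n + 2) => (0 : ℝ)) r) (s r).toNNReal) P' :=
    hZ
  have hconv := kArm_homogeneity_localPower_unequalSizes (h := fun _ => (0 : ℝ)) hs hlam hSm hVm hclt
    hZm hZ0 hind hV hm c
  have hκ : ∑ r, ((0 : ℝ) / Real.sqrt (lam r)
      - (∑ j, ((0 : ℝ) / Real.sqrt (lam j)) / (s j / lam j)) / (∑ j, (s j / lam j)⁻¹)) ^ 2 / (s r / lam r) = 0 := by
    simp
  simp only [hκ, Real.sqrt_zero] at hconv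
  rw [shiftedBall_zero_eq_erase (zero_ne_one : (0 : Fin (n + 2)) ≠ 1)] at hconv
  exact hconv

end KArm

end Summit.Ventures.LatticeQCDFlow.Scoring
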